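import Summits.ValiantsHypothesis.ValiantsHypothesis.Theorems.TwistedDetRankSliceVBPFermionicDEven
import Summits.ValiantsHypothesis.ValiantsHypothesis.Theorems.TwistedDetRankTdrPerNotQPStubConePowerRankThree
import Summits.ValiantsHypothesis.ValiantsHypothesis.Theorems.TwistedDetRankTdrPerNotQPStubConeRestriction
import Summits.ValiantsHypothesis.ValiantsHypothesis.Theorems.TwistedDetRankSliceVBPFermionicTdrTransfer

/-!
# Crux `TwistedDetRank.SliceVBPFermionic` (stmt-ValiantsHypothesis-17991, X2b) — the last falsifier
# `D^even` is NOT tdr-blind: `tdr(D^even_{6m}) ≥ 2^m` by a `2 × 2` flattening of the Birkhoff cone `Y_6`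

The census (Cruxes/SliceVBPFermionic/CALIBRATION.md §3) recorded `D^even = Σ_{σ all-even} sgn σ X^σ`
as "flattening-blind" (the block-swap test matrix of `[all cycles even]` has rank `1`).  Here the
tree's Kronecker-power method (Theorems/TwistedDetRankTdrPerNotQPStubConePowerRankThree.lean) is
run at block size `6` with a QUADRIC of the cone: in `𝔖_6`, `A = (01)(23)(45)`, `D = (0 2 1 4 3 5)`,
`B = (0 2 1)(3 5 4)`, `C = (0 1 4 5)(2 3)` satisfy `A + D = B + C` as `0/1` matrices, so
`L(z) = [[z A, z B], [z C, z D]]` has rank `≤ 1` on the cone (`dEvenTdr_cone_quadric`), while at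
`𝟙ₑ = sgn · dEvenClass` (`A, D, C` all-even, `B` two `3`-cycles) `L(𝟙ₑ) = [[1, 0], [1, 1]]`
(`dEvenTdr_exists_flattening`; found by exhaustive search — `𝔖_2, 𝔖_4` have no such relation).
With the Young-subgroup restriction for an arbitrary GMF (`gmf_coeff_of_eq_sum_twistedDet`,
`allEven_blockPerm_iff`): `tdr(D^even_{6m}) ≥ 2^m` (`dEven_two_pow_le`), `dEven_not_qpTdr`, and
`sliceVBPFermionic_at_dEven_iff` — X2b AT `D^even` is exactly "`D^even` is not in the VBP slice",
a concrete prediction settled under Valiant's hypothesis by the sequel (layer-switch gadget).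
HONEST FRAMING: a restricted-model lower bound for one family; X2b (≥ `VNP ⊄ VBP`) is neither
proved nor refuted; `VP ≠ VNP` is not moved.  References: Marcus–Minc, Illinois J. Math. 5 (1961);
J. M. Landsberg, *Geometry and Complexity Theory* (2017) §2.1; Mertens–Moore, ToC 9 (2013).
-/

-- single-conjunct layout: Sub = Summit, duplicated namespace component intended
set_option linter.dupNamespace false

noncomputable section

namespace Summit.ValiantsHypothesis.ValiantsHypothesis.Theorems.TwistedDetRankSliceVBPFermionic

open Equiv Equiv.Perm MvPolynomial Matrix Finset Literature.Computability.AlgebraicComplexity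
open Summit.ValiantsHypothesis.ValiantsHypothesis.Theorems.TwistedDetRankTdrPerNotQP

/-! ## §1 `2 × 2` flattenings by four permutations and the Kronecker-power argument -/

section Flattening

/-- The flattening written out: `L(z) = [[z A, z B], [z C, z D]]`. [folklore] -/
theorem dEvenTdr_flat_eq (A B C D : Perm (Fin 6)) (z : Perm (Fin 6) → ℂ) :
    (Matrix.of fun a c => ∑ σ, z σ *
        (!![Pi.single A 1, Pi.single B 1; Pi.single C 1, Pi.single D 1] :
          Matrix (Fin 2) (Fin 2) (Perm (Fin 6) → ℂ)) a c σ) = !![z A, z B; z C, z D] := by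
  ext a c
  fin_cases a <;> fin_cases c <;> simp [Pi.single_apply]

/-- `det L(z) = z A · z D - z B · z C`. [folklore] -/
theorem dEvenTdr_det_flat (A B C D : Perm (Fin 6)) (z : Perm (Fin 6) → ℂ) :
    (Matrix.of fun a c => ∑ σ, z σ *
        (!![Pi.single A 1, Pi.single B 1; Pi.single C 1, Pi.single D 1] :
          Matrix (Fin 2) (Fin 2) (Perm (Fin 6) → ℂ)) a c σ).det = z A * z D - z B * z C := by
  rw [dEvenTdr_flat_eq, Matrix.det_fin_two]
  simp

/-- A singular `2 × 2` matrix has rank `≤ 1` (a kernel vector exists, rank–nullity). [folklore] -/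
theorem dEvenTdr_rank_le_one_of_det_eq_zero (M : Matrix (Fin 2) (Fin 2) ℂ) (hM : M.det = 0) :
    M.rank ≤ 1 := by
  obtain ⟨v, hv0, hv⟩ := Matrix.exists_mulVec_eq_zero_iff.2 hM
  have hker : 1 ≤ Module.finrank ℂ (LinearMap.ker M.mulVecLin) := by
    rw [Nat.one_le_iff_ne_zero]
    intro h0
    have hbot : LinearMap.ker M.mulVecLin = ⊥ := Submodule.finrank_eq_zero.1 h0
    have : v ∈ LinearMap.ker M.mulVecLin := by
      rw [LinearMap.mem_ker, Matrix.mulVecLin_apply]; exact hv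
    rw [hbot, Submodule.mem_bot] at this
    exact hv0 this
  have hrn := LinearMap.finrank_range_add_finrank_ker M.mulVecLin
  rw [Module.finrank_fin_fun] at hrn
  unfold Matrix.rank
  omega

/-- `M_F` is additive (stated with the sum as a hypothesis). [folklore] -/
theorem dEvenTdr_bigFlat_sum (Λ : Matrix (Fin 2) (Fin 2) (Perm (Fin 6) → ℂ)) {m r : ℕ}
    (G : (Fin m → Perm (Fin 6)) → ℂ) (F : Fin r → (Fin m → Perm (Fin 6)) → ℂ)
    (hG : ∀ π, G π = ∑ t, F t π) :
    (Matrix.of fun (a c : Fin m → Fin 2) =>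
        ∑ π : Fin m → Perm (Fin 6), G π * ∏ j, Λ (a j) (c j) (π j)) =
      ∑ t, Matrix.of fun (a c : Fin m → Fin 2) =>
        ∑ π : Fin m → Perm (Fin 6), F t π * ∏ j, Λ (a j) (c j) (π j) := by
  ext a c
  simp only [Matrix.of_apply, Matrix.sum_apply, hG, Finset.sum_mul]
  rw [Finset.sum_comm]

/-- `M_F` of a product function is the Kronecker power of the flattenings (stated with the product
structure and the flattenings as hypotheses). [folklore] -/
theorem dEvenTdr_bigFlat_prod (Λ : Matrix (Fin 2) (Fin 2) (Perm (Fin 6) → ℂ)) {m : ℕ}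
    (F : (Fin m → Perm (Fin 6)) → ℂ) (f : Fin m → Perm (Fin 6) → ℂ) (hF : ∀ π, F π = ∏ j, f j (π j))
    (M : Fin m → Matrix (Fin 2) (Fin 2) ℂ) (hM : ∀ j a c, M j a c = ∑ σ, f j σ * Λ a c σ) :
    (Matrix.of fun (a c : Fin m → Fin 2) =>
        ∑ π : Fin m → Perm (Fin 6), F π * ∏ j, Λ (a j) (c j) (π j)) =
      Matrix.of fun (a c : Fin m → Fin 2) => ∏ j, M j (a j) (c j) := by
  ext a c
  simp only [Matrix.of_apply, hF, hM, ← Finset.prod_mul_distrib]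
  exact (Fintype.prod_sum fun j σ => f j σ * Λ (a j) (c j) σ).symm

/-- **The Kronecker-power argument for a `2 × 2` flattening.**  If a linear flattening `Λ` of
`ℂ^{𝔖_6}` has rank `≤ 1` on the Birkhoff cone and is invertible at `f`, then every cone product
decomposition `Π_b f(π_b) = Σ_{t<r} Π_b û_{t,b}(π_b)` of `f^{⊗m}` has `2^m ≤ r`. [folklore] -/
theorem dEvenTdr_conePowerRank_of_flattening (Λ : Matrix (Fin 2) (Fin 2) (Perm (Fin 6) → ℂ))
    (f : Perm (Fin 6) → ℂ)
    (hcone : ∀ u : Matrix (Fin 6) (Fin 6) ℂ,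
      (Matrix.of fun a c => ∑ σ, (∏ i, u (σ i) i) * Λ a c σ).rank ≤ 1)
    (hunit : (Matrix.of fun a c => ∑ σ, f σ * Λ a c σ) *
      (Matrix.of fun a c => ∑ σ, f σ * Λ a c σ)⁻¹ = 1)
    (m r : ℕ) (u : Fin r → Fin m → Matrix (Fin 6) (Fin 6) ℂ)
    (hu : ∀ π : Fin m → Perm (Fin 6), ∑ t, ∏ b, ∏ i, u t b (π b i) i = ∏ b, f (π b)) :
    2 ^ m ≤ r := by
  let S : Matrix (Fin 2) (Fin 2) ℂ := Matrix.of fun a c => ∑ σ, f σ * Λ a c σ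
  let T : Fin r → Fin m → Matrix (Fin 2) (Fin 2) ℂ := fun t j => Matrix.of fun a c =>
    ∑ σ, (fun τ : Perm (Fin 6) => ∏ i, u t j (τ i) i) σ * Λ a c σ
  have hmat : (Matrix.of fun (a c : Fin m → Fin 2) => ∏ j, (fun _ : Fin m => S) j (a j) (c j)) =
      ∑ t, Matrix.of fun (a c : Fin m → Fin 2) => ∏ j, T t j (a j) (c j) := by
    rw [← dEvenTdr_bigFlat_prod Λ (fun π => ∏ j, f (π j)) (fun _ => f) (fun _ => rfl)
      (fun _ => S) (fun _ _ _ => rfl)]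
    rw [dEvenTdr_bigFlat_sum Λ (fun π => ∏ j, f (π j))
      (fun t π => ∏ j, ∏ i, u t j (π j i) i) (fun π => (hu π).symm)]
    refine Finset.sum_congr rfl fun t _ => ?_
    exact dEvenTdr_bigFlat_prod Λ _ (fun j τ => ∏ i, u t j (τ i) i) (fun _ => rfl)
      (T t) (fun _ _ _ => rfl)
  have hL : (Matrix.of fun (a c : Fin m → Fin 2) =>
      ∏ j, (fun _ : Fin m => S) j (a j) (c j)).rank = 2 ^ m := by
    rw [conePowerRankThree_rank_kron_of_mul_eq_one (fun _ : Fin m => S) (fun _ => S⁻¹)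
      fun _ => hunit]
    simp
  have hR : (∑ t, Matrix.of fun (a c : Fin m → Fin 2) => ∏ j, T t j (a j) (c j)).rank ≤ r := by
    refine (conePowerRankThree_rank_sum_le _ _).trans ?_
    have hterm : ∀ t : Fin r,
        (Matrix.of fun (a c : Fin m → Fin 2) => ∏ j, T t j (a j) (c j)).rank ≤ 1 := by
      intro t
      refine (conePowerRankThree_rank_kron_le (T t)).trans ?_
      calc ∏ j, (T t j).rank ≤ ∏ _j : Fin m, 1 :=
            Finset.prod_le_prod' fun j _ => hcone (u t j)
        _ = 1 := by simp
    calc ∑ t, (Matrix.of fun (a c : Fin m → Fin 2) => ∏ j, T t j (a j) (c j)).rank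
        ≤ ∑ _t : Fin r, 1 := Finset.sum_le_sum fun t _ => hterm t
      _ = r := by simp
  rw [← hL, hmat]
  exact hR

end Flattening

/-! ## §2 The quadric `z_A z_D = z_B z_C` of `Y_6` and the all-even indicator -/

section Quadric

/-- `sgn σ · dEvenClass σ` is the all-even indicator. [folklore] -/
theorem sign_mul_dEvenClass {α : Type*} [Fintype α] [DecidableEq α] (σ : Perm α) :
    ((Perm.sign σ : ℤ) : ℂ) * dEvenClass σ =
      if (∀ x, σ x ≠ x) ∧ (∀ l ∈ σ.cycleType, Even l) then (1 : ℂ) else 0 := by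
  unfold dEvenClass
  split_ifs with h
  · rcases Int.units_eq_one_or (Perm.sign σ) with h1 | h1 <;> simp [h1]
  · exact mul_zero _

/-- **The quadric vanishes on the cone.** With `A = (01)(23)(45)`, `D = (0 2 1 4 3 5)`,
`B = (0 2 1)(3 5 4)`, `C = (0 1 4 5)(2 3)` one has `A + D = B + C` as `0/1`-matrices, hence
`û(A) û(D) = û(B) û(C)` for every `û(σ) = Π_i u (σ i) i`. [folklore] -/
theorem dEvenTdr_cone_quadric (u : Matrix (Fin 6) (Fin 6) ℂ) :
    (∏ i, u ((swap (0 : Fin 6) 1 * swap 2 3 * swap 4 5 : Perm (Fin 6)) i) i) *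
        (∏ i, u ((swap (0 : Fin 6) 2 * swap 2 1 * swap 1 4 * swap 4 3 * swap 3 5 : Perm (Fin 6)) i) i) -
      (∏ i, u ((swap (0 : Fin 6) 2 * swap 2 1 * (swap 3 5 * swap 5 4) : Perm (Fin 6)) i) i) *
        (∏ i, u ((swap (0 : Fin 6) 1 * swap 1 4 * swap 4 5 * swap 2 3 : Perm (Fin 6)) i) i) = 0 := by
  simp only [Fin.prod_univ_six, Perm.mul_apply]
  simp [Equiv.swap_apply_def]
  ring

/-- `A = (01)(23)(45)`, `D = (0 2 1 4 3 5)`, `C = (0 1 4 5)(2 3)` are all-even (explicit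
`2`-colourings) and `B = (0 2 1)(3 5 4)` is not (`B³` fixes `0`): the indicator values
`1, 1, 1, 0`. [folklore] -/
theorem dEvenTdr_indicator_values :
    ((Perm.sign (swap (0 : Fin 6) 1 * swap 2 3 * swap 4 5 : Perm (Fin 6)) : ℤ) : ℂ) *
        dEvenClass (swap (0 : Fin 6) 1 * swap 2 3 * swap 4 5 : Perm (Fin 6)) = 1 ∧
      ((Perm.sign (swap (0 : Fin 6) 2 * swap 2 1 * swap 1 4 * swap 4 3 * swap 3 5 : Perm (Fin 6)) : ℤ) : ℂ) *
        dEvenClass (swap (0 : Fin 6) 2 * swap 2 1 * swap 1 4 * swap 4 3 * swap 3 5 : Perm (Fin 6)) = 1 ∧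
      ((Perm.sign (swap (0 : Fin 6) 1 * swap 1 4 * swap 4 5 * swap 2 3 : Perm (Fin 6)) : ℤ) : ℂ) *
        dEvenClass (swap (0 : Fin 6) 1 * swap 1 4 * swap 4 5 * swap 2 3 : Perm (Fin 6)) = 1 ∧
      ((Perm.sign (swap (0 : Fin 6) 2 * swap 2 1 * (swap 3 5 * swap 5 4) : Perm (Fin 6)) : ℤ) : ℂ) *
        dEvenClass (swap (0 : Fin 6) 2 * swap 2 1 * (swap 3 5 * swap 5 4) : Perm (Fin 6)) = 0 := by
  refine ⟨?_, ?_, ?_, ?_⟩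
  · rw [sign_mul_dEvenClass,
      if_pos (allEven_of_antiInvariant ![false, true, false, true, false, true] (by decide))]
  · rw [sign_mul_dEvenClass,
      if_pos (allEven_of_antiInvariant ![false, false, true, false, true, true] (by decide))]
  · rw [sign_mul_dEvenClass,
      if_pos (allEven_of_antiInvariant ![false, true, false, true, false, true] (by decide))]
  · rw [dEvenClass_eq_zero_of_pow_apply_eq_self (n := 3) (x := (0 : Fin 6)) (by decide) (by decide),
      mul_zero]

/-- **The flattening of `D^even` at block size `6`.**  There is a `2 × 2` linear flattening of
`ℂ^{𝔖_6}` of rank `≤ 1` on the Birkhoff cone and invertible at the all-even indicator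
`sgn · dEvenClass` (namely `L(z) = [[z A, z B], [z C, z D]]` with the four permutations of
`dEvenTdr_cone_quadric`: `det L = z_A z_D - z_B z_C` vanishes on the cone and
`L(𝟙ₑ) = [[1, 0], [1, 1]]`). [folklore] -/
theorem dEvenTdr_exists_flattening :
    ∃ Λ : Matrix (Fin 2) (Fin 2) (Perm (Fin 6) → ℂ),
      (∀ u : Matrix (Fin 6) (Fin 6) ℂ,
        (Matrix.of fun a c => ∑ σ, (∏ i, u (σ i) i) * Λ a c σ).rank ≤ 1) ∧
      (Matrix.of fun a c => ∑ σ, (((Perm.sign σ : ℤ) : ℂ) * dEvenClass σ) * Λ a c σ) *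
        (Matrix.of fun a c => ∑ σ, (((Perm.sign σ : ℤ) : ℂ) * dEvenClass σ) * Λ a c σ)⁻¹ = 1 := by
  refine ⟨!![Pi.single (swap (0 : Fin 6) 1 * swap 2 3 * swap 4 5 : Perm (Fin 6)) 1,
      Pi.single (swap (0 : Fin 6) 2 * swap 2 1 * (swap 3 5 * swap 5 4) : Perm (Fin 6)) 1;
      Pi.single (swap (0 : Fin 6) 1 * swap 1 4 * swap 4 5 * swap 2 3 : Perm (Fin 6)) 1,
      Pi.single (swap (0 : Fin 6) 2 * swap 2 1 * swap 1 4 * swap 4 3 * swap 3 5 : Perm (Fin 6)) 1], ?_, ?_⟩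
  · intro u
    apply dEvenTdr_rank_le_one_of_det_eq_zero
    rw [dEvenTdr_det_flat]
    exact dEvenTdr_cone_quadric u
  · refine Matrix.mul_nonsing_inv _ ?_
    rw [dEvenTdr_det_flat]
    obtain ⟨h1, h2, h3, h4⟩ := dEvenTdr_indicator_values
    simp only [h1, h2, h3, h4]
    norm_num

/-- **Cone product rank of `𝟙ₑ^{⊗m}`** (`𝟙ₑ = sgn · dEvenClass` on `𝔖_6`): every decomposition
`Π_b 𝟙ₑ(π_b) = Σ_{t<r} Π_b Π_i u t b (π_b i) i` into products of Birkhoff-cone points has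
`2^m ≤ r`. [folklore] -/
theorem dEven_conePowerRank (m r : ℕ) (u : Fin r → Fin m → Matrix (Fin 6) (Fin 6) ℂ)
    (hu : ∀ π : Fin m → Perm (Fin 6),
      ∑ t, ∏ b, ∏ i, u t b (π b i) i = ∏ b, (((Perm.sign (π b) : ℤ) : ℂ) * dEvenClass (π b))) :
    2 ^ m ≤ r := by
  obtain ⟨Λ, hcone, hunit⟩ := dEvenTdr_exists_flattening
  exact dEvenTdr_conePowerRank_of_flattening Λ _ hcone hunit m r u hu

end Quadric

/-! ## §3 Young-subgroup restriction for `D^even` and the lower bound -/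

section Restriction

/-- **Coefficient form of a twisted representation of a GMF.** If
`Σ_σ χ(σ) X^σ = Σ_t det(X ∘ E_t)` then `χ(σ) = sgn σ · Σ_t Π_i E_t (σ i) i` for every `σ`
(compare coefficients of the distinct permutation monomials). [folklore] -/
theorem gmf_coeff_of_eq_sum_twistedDet {n r : ℕ} (χ : Perm (Fin n) → ℂ)
    (E : Fin r → Matrix (Fin n) (Fin n) ℂ)
    (h : (∑ σ : Perm (Fin n), C (χ σ) * ∏ i, (X (σ i, i) : MvPolynomial (Fin n × Fin n) ℂ)) =
      ∑ t, (Matrix.of fun i j => C (E t i j) * (X (i, j) : MvPolynomial (Fin n × Fin n) ℂ)).det)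
    (σ : Perm (Fin n)) :
    χ σ = ((Perm.sign σ : ℤ) : ℂ) * ∑ t, ∏ i, E t (σ i) i := by
  have hL : (∑ σ : Perm (Fin n), C (χ σ) * ∏ i, (X (σ i, i) : MvPolynomial (Fin n × Fin n) ℂ)) =
      ∑ σ : Perm (Fin n), monomial (permMonomial σ) (χ σ) := by
    refine Finset.sum_congr rfl fun σ _ => ?_
    rw [TwistedDetRankTdrSuperadditive.prod_X_eq_monomial, C_mul_monomial, mul_one]
  have hc := congrArg (coeff (permMonomial σ)) h
  rw [hL, TwistedDetRankTdrSuperadditive.coeff_permMonomial_sum_monomial, coeff_sum] at hc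
  simp only [TwistedDetRankTdrSuperadditive.coeff_permMonomial_twistedDet] at hc
  rw [← Finset.mul_sum] at hc
  exact hc

/-- For `D^even`: a twisted representation is the cone identity `Σ_t Ê_t(σ) = sgn σ · dEvenClass σ`
(`= [σ all-even]`). [folklore] -/
theorem dEven_cone_coeff {n r : ℕ} (E : Fin r → Matrix (Fin n) (Fin n) ℂ)
    (h : (∑ σ : Perm (Fin n), C (dEvenClass σ) *
        ∏ i, (X (σ i, i) : MvPolynomial (Fin n × Fin n) ℂ)) =
      ∑ t, (Matrix.of fun i j => C (E t i j) * (X (i, j) : MvPolynomial (Fin n × Fin n) ℂ)).det)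
    (σ : Perm (Fin n)) :
    ∑ t, ∏ i, E t (σ i) i = ((Perm.sign σ : ℤ) : ℂ) * dEvenClass σ := by
  have hc := gmf_coeff_of_eq_sum_twistedDet dEvenClass E h σ
  have hs := TwistedDetRankTdrSuperadditive.sign_mul_sign_self σ
  calc ∑ t, ∏ i, E t (σ i) i
      = ((Perm.sign σ : ℤ) : ℂ) * (((Perm.sign σ : ℤ) : ℂ) * ∑ t, ∏ i, E t (σ i) i) := by
        rw [← mul_assoc, hs, one_mul]
    _ = ((Perm.sign σ : ℤ) : ℂ) * dEvenClass σ := by rw [← hc]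

/-- Powers of a block permutation act blockwise. [folklore] -/
theorem prodCongrRight_pow_apply {m k : ℕ} (π : Fin m → Perm (Fin k)) (n : ℕ) (b : Fin m)
    (i : Fin k) : ((Equiv.prodCongrRight π : Perm (Fin m × Fin k)) ^ n) (b, i) = (b, (π b ^ n) i) := by
  induction n generalizing i with
  | zero => simp
  | succ n ih => rw [pow_succ, Perm.mul_apply, Equiv.prodCongrRight_apply, ih, pow_succ, Perm.mul_apply]

/-- The odd-power criterion transports along an equivalence of index types. [folklore] -/
theorem forall_odd_pow_permCongr {α β : Type*} (e : α ≃ β) (P : Perm α) :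
    (∀ (n : ℕ) (y : β), Odd n → ((e.permCongr P) ^ n) y ≠ y) ↔
      ∀ (n : ℕ) (x : α), Odd n → (P ^ n) x ≠ x := by
  have hpow : ∀ n : ℕ, (e.permCongr P) ^ n = e.permCongr (P ^ n) := fun n =>
    (map_pow e.permCongrHom P n).symm
  constructor
  · intro h n x hn hx
    apply h n (e x) hn
    rw [hpow, Equiv.permCongr_apply, Equiv.symm_apply_apply, hx]
  · intro h n y hn hy
    apply h n (e.symm y) hn
    rw [hpow, Equiv.permCongr_apply] at hy
    simpa using congrArg e.symm hy

/-- **A block permutation is all-even iff every block is** (odd powers act blockwise).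
[folklore] -/
theorem allEven_blockPerm_iff {m k : ℕ} (π : Fin m → Perm (Fin k)) :
    ((∀ x, (finProdFinEquiv.permCongr (Equiv.prodCongrRight π)) x ≠ x) ∧
        ∀ l ∈ (finProdFinEquiv.permCongr (Equiv.prodCongrRight π)).cycleType, Even l) ↔
      ∀ b, (∀ i, π b i ≠ i) ∧ ∀ l ∈ (π b).cycleType, Even l := by
  rw [allEven_iff_forall_odd_pow, forall_odd_pow_permCongr]
  simp_rw [allEven_iff_forall_odd_pow]
  constructor
  · intro h b n i hn hi
    apply h n (b, i) hn
    rw [prodCongrRight_pow_apply, hi]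
  · rintro h n ⟨b, i⟩ hn hbi
    rw [prodCongrRight_pow_apply] at hbi
    exact h b n i hn (Prod.ext_iff.1 hbi).2

/-- **Young-subgroup restriction for `D^even`.** A representation of `D^even_{m·6}` by `r`
twisted determinants yields a length-`r` cone product decomposition of the `m`-th tensor power of
the all-even indicator `sgn · dEvenClass` of `𝔖_6`. [folklore] -/
theorem dEven_coneRestriction (m r : ℕ) (E : Fin r → Matrix (Fin (m * 6)) (Fin (m * 6)) ℂ)
    (hE : (∑ σ : Perm (Fin (m * 6)), C (dEvenClass σ) *
        ∏ i, (X (σ i, i) : MvPolynomial (Fin (m * 6) × Fin (m * 6)) ℂ)) =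
      ∑ t, (Matrix.of fun i j => C (E t i j) * (X (i, j) : MvPolynomial _ ℂ)).det) :
    ∃ u : Fin r → Fin m → Matrix (Fin 6) (Fin 6) ℂ,
      ∀ π : Fin m → Perm (Fin 6),
        ∑ t, ∏ b, ∏ i, u t b (π b i) i =
          ∏ b, (((Perm.sign (π b) : ℤ) : ℂ) * dEvenClass (π b)) := by
  refine ⟨fun t b i' i => E t (finProdFinEquiv (b, i')) (finProdFinEquiv (b, i)), fun π => ?_⟩
  calc ∑ t, ∏ b, ∏ i, E t (finProdFinEquiv (b, π b i)) (finProdFinEquiv (b, i))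
      = ∑ t, ∏ k, E t ((finProdFinEquiv.permCongr (Equiv.prodCongrRight π)) k) k :=
        Finset.sum_congr rfl fun t _ => (coneRestriction_prod_blockPerm (E t) π).symm
    _ = ((Perm.sign (finProdFinEquiv.permCongr (Equiv.prodCongrRight π)) : ℤ) : ℂ) *
          dEvenClass (finProdFinEquiv.permCongr (Equiv.prodCongrRight π)) := dEven_cone_coeff E hE _
    _ = ∏ b, (((Perm.sign (π b) : ℤ) : ℂ) * dEvenClass (π b)) := by
        rw [sign_mul_dEvenClass]
        simp_rw [sign_mul_dEvenClass]
        by_cases hall : ∀ b, (∀ i, π b i ≠ i) ∧ ∀ l ∈ (π b).cycleType, Even l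
        · rw [if_pos ((allEven_blockPerm_iff π).2 hall)]
          exact (Finset.prod_eq_one fun b _ => by rw [if_pos (hall b)]).symm
        · rw [if_neg (fun h => hall ((allEven_blockPerm_iff π).1 h))]
          obtain ⟨b, hb⟩ := not_forall.1 hall
          exact (Finset.prod_eq_zero (Finset.mem_univ b) (by rw [if_neg hb])).symm

/-- **`tdr(D^even_{6m}) ≥ 2^m`.** Every representation of `D^even_{m·6}` as a sum of `r`
Hadamard-twisted determinants has `2^m ≤ r`. [folklore] -/
theorem dEven_two_pow_le (m r : ℕ) (E : Fin r → Matrix (Fin (m * 6)) (Fin (m * 6)) ℂ)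
    (hE : (∑ σ : Perm (Fin (m * 6)), C (dEvenClass σ) *
        ∏ i, (X (σ i, i) : MvPolynomial (Fin (m * 6) × Fin (m * 6)) ℂ)) =
      ∑ t, (Matrix.of fun i j => C (E t i j) * (X (i, j) : MvPolynomial _ ℂ)).det) :
    2 ^ m ≤ r := by
  obtain ⟨u, hu⟩ := dEven_coneRestriction m r E hE
  exact dEven_conePowerRank m r u hu

/-- **`D^even` does NOT have quasi-polynomially bounded twisted-determinantal rank** — the
conclusion of X2b fails for the family `n ↦ D^even_n` unconditionally (`2^m ≤ tdr(D^even_{6m})`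
against `2^((log₂ 6m + c)^c) < 2^m` for large `m`). [folklore] -/
theorem dEven_not_qpTdr :
    ¬ ∃ c : ℕ, ∀ n : ℕ, 1 ≤ n → ∃ r ≤ 2 ^ ((Nat.log 2 n + c) ^ c),
      ∃ E : Fin r → Matrix (Fin n) (Fin n) ℂ,
        (∑ σ : Perm (Fin n), C (dEvenClass σ) *
            ∏ i, (X (σ i, i) : MvPolynomial (Fin n × Fin n) ℂ)) =
          ∑ t, (Matrix.of fun i j => C (E t i j) * MvPolynomial.X (i, j)).det := by
  rintro ⟨c, hc⟩
  have hε : (0 : ℝ) < 1 / 6 := by norm_num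
  obtain ⟨n₀, hn₀⟩ :=
    Summit.ValiantsHypothesis.Theorems.ProofCarryingSymmetry.natLog_add_pow_lt_mul_eventually c hε
  set m : ℕ := max n₀ 1 with hm_def
  have hm1 : 1 ≤ m := le_max_right _ _
  have hmn : n₀ ≤ m * 6 := by have : n₀ ≤ m := le_max_left _ _; omega
  obtain ⟨r, hr, E, hE⟩ := hc (m * 6) (by omega)
  have h2 : 2 ^ m ≤ r := dEven_two_pow_le m r E hE
  have hlt := hn₀ (m * 6) hmn
  set k : ℕ := (Nat.log 2 (m * 6) + c) ^ c with hk
  have hkm : k < m := by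
    have h' : (k : ℝ) < (m : ℝ) := by
      have : (1 : ℝ) / 6 * ((m * 6 : ℕ) : ℝ) = (m : ℝ) := by push_cast; ring
      rw [← this]; exact hlt
    exact_mod_cast h'
  have h3 : r < 2 ^ m := lt_of_le_of_lt hr (Nat.pow_lt_pow_right (by norm_num) hkm)
  omega

/-- **X2b AT `D^even` is the statement "`D^even` is not in the VBP slice".**  Since the conclusion
of `SliceVBPFermionic` fails for `D^even` (`dEven_not_qpTdr`), its instance at this family holds
iff the hypothesis fails, i.e. iff `dc(D^even_n)` is not polynomially bounded — a concrete
prediction of X2b, no longer blind to the twisted rank. [folklore] -/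
theorem sliceVBPFermionic_at_dEven_iff :
    ((∃ c : ℕ, ∀ n : ℕ, ∃ m ≤ n ^ c + c,
      HasDetRepr (∑ σ : Perm (Fin n), C (dEvenClass σ) *
        ∏ i, (X (σ i, i) : MvPolynomial (Fin n × Fin n) ℂ)) m) →
    ∃ c : ℕ, ∀ n : ℕ, 1 ≤ n → ∃ r ≤ 2 ^ ((Nat.log 2 n + c) ^ c),
      ∃ E : Fin r → Matrix (Fin n) (Fin n) ℂ,
        (∑ σ : Perm (Fin n), C (dEvenClass σ) *
            ∏ i, (X (σ i, i) : MvPolynomial (Fin n × Fin n) ℂ)) =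
          ∑ t, (Matrix.of fun i j => C (E t i j) * MvPolynomial.X (i, j)).det) ↔
    ¬ ∃ c : ℕ, ∀ n : ℕ, ∃ m ≤ n ^ c + c,
      HasDetRepr (∑ σ : Perm (Fin n), C (dEvenClass σ) *
        ∏ i, (X (σ i, i) : MvPolynomial (Fin n × Fin n) ℂ)) m :=
  ⟨fun h hdc => dEven_not_qpTdr (h hdc), fun h hdc => absurd hdc h⟩

end Restriction

end Summit.ValiantsHypothesis.ValiantsHypothesis.Theorems.TwistedDetRankSliceVBPFermionic

end
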